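import Literature.MathematicalPhysics.QuantumFieldTheory.ConformalBootstrap3D.PointKernel

/-!
# Head cells checked in PARTS: one `decide` per range of descendant levels

A head cell of the B″ point-certificate kernel (`PointKernel.PCert.cellOK` corner /
`PointKernel.PCert.cellOKC` chord) evaluates, for every descendant level `n ≤ n_F` and spin `j`, a
dot product over the nodes; its cost grows like `n_F²`.  Near an LP-active zero of the functional
(the first cells above a unitarity bound `Δ = ℓ + 1` or above `ε_lo`) a cell needs a large head
level `n_F` (60–80), and one such cell is more kernel work than a single `decide` reduction
sustains.  This file checks the SAME number in parts: the cell's integer lower sum is split over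
consecutive level ranges `[n_lo, n_lo + cnt)`, each part is compared by its own `decide` with a
claimed integer `B`, and the cell fact follows from `Σ B ≥ 0` (`PCert.cellP_sound`,
`PCert.cellCP_sound`).  A part-checked cell is carried by a one-cell head segment
(`PCert.hPartSideOK`, `PCert.hPartOK`, `PCert.hParts_sound`), so it delivers exactly the
`CellFact` that `PCert.boxExcluded_of_kernel[C][_unbounded]` consumes next to the block-checked
segments (`PCert.hBlockOK_sound`); nothing in the table theorem or its hypotheses changes.

References: Hogervorst–Rychkov, arXiv:1303.1111, §3 eq. (3.9) (the recursion whose head terms are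
summed); tree file `PointKernel` (the evaluator, its soundness lemmas `PCert.qLo_le`,
`PCert.qLoC_le`).
-/

namespace Literature.MathematicalPhysics.QuantumFieldTheory.ConformalBootstrap3D

namespace PointKernel

open Literature.Analysis.ValidatedNumerics (rsum rall vget vtab vget_vtab vget_of_length_le rsum_eq_sum
  rall_eq_true_iff of_rall)
open Literature.Analysis.ValidatedNumerics.NumericsMP
open Real Finset

/-! ### Parts: consecutive level ranges with claimed integer lower bounds -/

/-- the parts `(n_lo, cnt, B)` tile `[pos, top)` consecutively. [folklore] -/
def partsCover : ℕ → List (ℕ × ℕ × ℤ) → ℕ → Bool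
  | pos, [], top => decide (pos = top)
  | pos, p :: rest, top => decide (p.1 = pos) && partsCover (pos + p.2.1) rest top

/-- the sum of the claimed bounds. [folklore] -/
def partsSum : List (ℕ × ℕ × ℤ) → ℤ
  | [] => 0
  | p :: rest => p.2.2 + partsSum rest

/-- the parts tile the levels `0, …, n_F` and their claimed bounds add up to `≥ 0`. [folklore] -/
def partsOK (nF : ℕ) (parts : List (ℕ × ℕ × ℤ)) : Bool :=
  partsCover 0 parts (nF + 1) && decide (0 ≤ partsSum parts)

/-- a tiling starts below its top. [folklore] -/
theorem le_of_partsCover : ∀ (pos : ℕ) (parts : List (ℕ × ℕ × ℤ)) (top : ℕ),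
    partsCover pos parts top = true → pos ≤ top
  | pos, [], top, h => by
    simp only [partsCover, decide_eq_true_eq] at h
    omega
  | pos, p :: rest, top, h => by
    simp only [partsCover, Bool.and_eq_true, decide_eq_true_eq] at h
    have := le_of_partsCover _ _ _ h.2
    omega

/-- **Parts add up**: if every part's claim is below the partial sum of `f` over its range, the
claims add up to at most the sum of `f` over the tiled range. [folklore] -/
theorem partsSum_le_sum (f : ℕ → ℤ) : ∀ (parts : List (ℕ × ℕ × ℤ)) (pos top : ℕ),
    partsCover pos parts top = true →
    (∀ p ∈ parts, p.2.2 ≤ rsum p.2.1 fun i => f (p.1 + i)) →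
    partsSum parts ≤ ∑ n ∈ Ico pos top, f n
  | [], pos, top, h, _ => by
    simp only [partsCover, decide_eq_true_eq] at h
    subst h
    simp [partsSum]
  | p :: rest, pos, top, h, hp => by
    simp only [partsCover, Bool.and_eq_true, decide_eq_true_eq] at h
    obtain ⟨h1, h2⟩ := h
    have htop := le_of_partsCover _ _ _ h2
    have ih := partsSum_le_sum f rest (pos + p.2.1) top h2 fun q hq => hp q (List.mem_cons_of_mem _ hq)
    have h0 := hp p (by simp)
    rw [rsum_eq_sum, h1] at h0
    have e : ∑ i ∈ range p.2.1, f (pos + i) = ∑ n ∈ Ico pos (pos + p.2.1), f n := by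
      rw [Finset.sum_Ico_eq_sum_range]
      simp
    rw [← Finset.sum_Ico_consecutive f (Nat.le_add_right pos p.2.1) htop, ← e]
    simp only [partsSum]
    linarith

namespace PCert

variable (c : PCert)

/-! ### Corner cells in parts -/

/-- the level-`n` inner sum of the corner head-cell lower sum `cellLo`, given the cell's tables
`IU, IV` (shifted node tables) and `RAs, RBs` (HR rows, newest first). [folklore] -/
def qRow (ℓ : ℕ) (LT LTt : List (List ℚ)) (IU IV : List (List ℤ)) (RAs RBs : List (List ℚ))
    (ea eb : ℚ) (nF n : ℕ) : ℤ :=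
  let ρ := pivotProdQ (2 * ea) ℓ n / pivotProdQ (2 * eb) ℓ n
  let ρ' := pivotProdQ (2 * eb) ℓ n / pivotProdQ (2 * ea) ℓ n
  let RA := RAs.getD (nF - n) []
  let RB := RBs.getD (nF - n) []
  rsum (ℓ + nF + 1) fun j => qLo ℓ LT LTt IU IV RA RB ρ ρ' n j

/-- **Partial corner head-cell lower sum** over the levels `n_lo ≤ n < n_lo + cnt` (the tables are
computed once per part, as in `cellLo`). [folklore] -/
def cellLoP (nc : List NC4) (LT LTt : List (List ℚ)) (ℓ : ℕ) (ea eb : ℚ) (XA XB YA YB : List MI)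
    (nF nlo cnt : ℕ) : ℤ :=
  let IU := c.iuTab (c.duList nc XA XB) ℓ nF
  let IV := c.ivTab (c.dvList nc YA YB) ℓ nF
  let RAs := hrRowList (2 * ea) ℓ nF
  let RBs := hrRowList (2 * eb) ℓ nF
  rsum cnt fun i => qRow ℓ LT LTt IU IV RAs RBs ea eb nF (nlo + i)

variable {c}

/-- **Soundness of a corner head cell checked in parts**: side conditions, a tiling of the levels
with claims adding up to `≥ 0`, and every claim below its partial lower sum give
`0 ≤ headNumber … n_F false`. [folklore] -/
theorem cellP_sound (hc : c.checkNodes = true) {ℓ : ℕ} (ea eb : ℚ) (XA XB YA YB : List MI)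
    (hXA : ∀ k < c.N, MI.mem c.S (((c.u k : ℚ) : ℝ) ^ ((ea : ℚ) : ℝ)) (miAt XA k))
    (hXB : ∀ k < c.N, MI.mem c.S (((c.u k : ℚ) : ℝ) ^ ((eb : ℚ) : ℝ)) (miAt XB k))
    (hYA : ∀ k < c.N, MI.mem c.S (((c.v k : ℚ) : ℝ) ^ ((ea : ℚ) : ℝ)) (miAt YA k))
    (hYB : ∀ k < c.N, MI.mem c.S (((c.v k : ℚ) : ℝ) ^ ((eb : ℚ) : ℝ)) (miAt YB k))
    (nF : ℕ) {J : ℕ} (hJ : ℓ + nF ≤ J) (hside : cellSideOK ℓ ea eb nF = true)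
    (parts : List (ℕ × ℕ × ℤ)) (hcov : partsOK nF parts = true)
    (hparts : ∀ p ∈ parts,
      p.2.2 ≤ c.cellLoP c.ncTab (c.legTabs J) (c.legTabsT J) ℓ ea eb XA XB YA YB nF p.1 p.2.1) :
    0 ≤ headNumber c.wR c.zR c.zbR ℓ (((2 * ea : ℚ)) : ℝ) (((2 * eb : ℚ)) : ℝ) ((c.slo : ℚ) : ℝ)
      ((c.shi : ℚ) : ℝ) nF false := by
  have hS := S_pos hc
  have hSR : (0 : ℝ) < c.S := by exact_mod_cast hS
  simp only [cellSideOK, Bool.and_eq_true, decide_eq_true_eq] at hside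
  obtain ⟨hℓ, hall⟩ := hside
  simp only [partsOK, Bool.and_eq_true, decide_eq_true_eq] at hcov
  obtain ⟨hcov, hsum⟩ := hcov
  -- the claims add up to at most the full lower sum
  have hL := partsSum_le_sum
    (fun n => qRow ℓ (c.legTabs J) (c.legTabsT J) (c.iuTab (c.duList c.ncTab XA XB) ℓ nF)
      (c.ivTab (c.dvList c.ncTab YA YB) ℓ nF) (hrRowList (2 * ea) ℓ nF) (hrRowList (2 * eb) ℓ nF)
      ea eb nF n)
    parts 0 (nF + 1) hcov (fun p hp => by simpa [cellLoP] using hparts p hp)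
  rw [← Finset.range_eq_Ico] at hL
  have hlo : (0 : ℤ) ≤ ∑ n ∈ range (nF + 1),
      qRow ℓ (c.legTabs J) (c.legTabsT J) (c.iuTab (c.duList c.ncTab XA XB) ℓ nF)
        (c.ivTab (c.dvList c.ncTab YA YB) ℓ nF) (hrRowList (2 * ea) ℓ nF) (hrRowList (2 * eb) ℓ nF)
        ea eb nF n := le_trans hsum hL
  have hloR : (0 : ℝ) ≤ ((∑ n ∈ range (nF + 1),
      qRow ℓ (c.legTabs J) (c.legTabsT J) (c.iuTab (c.duList c.ncTab XA XB) ℓ nF)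
        (c.ivTab (c.dvList c.ncTab YA YB) ℓ nF) (hrRowList (2 * ea) ℓ nF) (hrRowList (2 * eb) ℓ nF)
        ea eb nF n : ℤ) : ℝ) := by
    exact_mod_cast hlo
  simp only [qRow, rsum_eq_sum, Int.cast_sum] at hloR
  simp only [headNumber, Bool.false_eq_true, ↓reduceIte, headCellBound, headSet, Finset.sum_product]
  have key : ∀ n ∈ range (nF + 1), ∀ j ∈ range (ℓ + nF + 1),
      ((qLo ℓ (c.legTabs J) (c.legTabsT J) (c.iuTab (c.duList c.ncTab XA XB) ℓ nF)
        (c.ivTab (c.dvList c.ncTab YA YB) ℓ nF) ((hrRowList (2 * ea) ℓ nF).getD (nF - n) [])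
        ((hrRowList (2 * eb) ℓ nF).getD (nF - n) [])
        (pivotProdQ (2 * ea) ℓ n / pivotProdQ (2 * eb) ℓ n)
        (pivotProdQ (2 * eb) ℓ n / pivotProdQ (2 * ea) ℓ n) n j : ℤ) : ℝ) ≤
      c.S * min
        (hrCoeff (((2 * ea : ℚ)) : ℝ) ℓ n j *
            (pivotProd (((2 * ea : ℚ)) : ℝ) ℓ n / pivotProd (((2 * eb : ℚ)) : ℝ) ℓ n) *
          termCornerBound c.wR c.zR c.zbR j ((((2 * ea : ℚ)) : ℝ) + (n : ℕ)) ((((2 * eb : ℚ)) : ℝ) + (n : ℕ))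
            ((c.slo : ℚ) : ℝ) ((c.shi : ℚ) : ℝ))
        (hrCoeff (((2 * eb : ℚ)) : ℝ) ℓ n j *
            (pivotProd (((2 * eb : ℚ)) : ℝ) ℓ n / pivotProd (((2 * ea : ℚ)) : ℝ) ℓ n) *
          termCornerBound c.wR c.zR c.zbR j ((((2 * ea : ℚ)) : ℝ) + (n : ℕ)) ((((2 * eb : ℚ)) : ℝ) + (n : ℕ))
            ((c.slo : ℚ) : ℝ) ((c.shi : ℚ) : ℝ)) := by
    intro n hn j hj
    rw [mem_range] at hn hj
    have hrow := of_rall hall hn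
    simp only [Bool.and_eq_true, decide_eq_true_eq] at hrow
    obtain ⟨⟨hpa, hpb⟩, hAB⟩ := hrow
    have hab := of_rall hAB hj
    simp only [Bool.and_eq_true, decide_eq_true_eq] at hab
    rw [hrRowList_getD _ _ _ _ (by omega), hrRowList_getD _ _ _ _ (by omega)]
    exact qLo_le hc hℓ ea eb XA XB YA YB hXA hXB hYA hYB nF hJ (by omega) (by omega) hpa hpb hab.1 hab.2
  have := sum_le_sum fun n hn => sum_le_sum fun j hj => key n hn j hj
  simp only [← mul_sum] at this
  nlinarith [this, hloR, hSR]

variable (c)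

/-! ### Chord cells in parts -/

/-- the level-`n` inner sum of the chord head-cell lower sum `cellLoC`, given the cell's eight
shifted node tables and HR rows. [folklore] -/
def qRowC (ℓ : ℕ) (LT LTt : List (List ℚ)) (IU00 IU10 IU01 IU11 IV00 IV10 IV01 IV11 : List (List ℤ))
    (RAs RBs : List (List ℚ)) (ea eb : ℚ) (nF n : ℕ) : ℤ :=
  let ρ := pivotProdQ (2 * ea) ℓ n / pivotProdQ (2 * eb) ℓ n
  let ρ' := pivotProdQ (2 * eb) ℓ n / pivotProdQ (2 * ea) ℓ n
  let RA := RAs.getD (nF - n) []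
  let RB := RBs.getD (nF - n) []
  rsum (ℓ + nF + 1) fun j => qLoC ℓ LT LTt IU00 IU10 IU01 IU11 IV00 IV10 IV01 IV11 RA RB ρ ρ' n j

/-- **Partial chord head-cell lower sum** over the levels `n_lo ≤ n < n_lo + cnt` (the tables are
computed once per part, as in `cellLoC`). [folklore] -/
def cellLoCP (ncc : List NCC) (LT LTt : List (List ℚ)) (ℓ : ℕ) (ea : ℚ) (t : ℕ) (XA YA : List MI)
    (nF nlo cnt : ℕ) : ℤ :=
  let eb := ea + atomExp c.rho t
  let IU00 := c.iuTab (c.duListC false false ncc t XA) ℓ nF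
  let IU10 := c.iuTab (c.duListC true false ncc t XA) ℓ nF
  let IU01 := c.iuTab (c.duListC false true ncc t XA) ℓ nF
  let IU11 := c.iuTab (c.duListC true true ncc t XA) ℓ nF
  let IV00 := c.ivTab (c.dvListC false false ncc t YA) ℓ nF
  let IV10 := c.ivTab (c.dvListC true false ncc t YA) ℓ nF
  let IV01 := c.ivTab (c.dvListC false true ncc t YA) ℓ nF
  let IV11 := c.ivTab (c.dvListC true true ncc t YA) ℓ nF
  let RAs := hrRowList (2 * ea) ℓ nF
  let RBs := hrRowList (2 * eb) ℓ nF
  rsum cnt fun i => qRowC ℓ LT LTt IU00 IU10 IU01 IU11 IV00 IV10 IV01 IV11 RAs RBs ea eb nF (nlo + i)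

variable {c}

/-- **Soundness of a chord head cell checked in parts.** [folklore] -/
theorem cellCP_sound (hc : c.checkNodes = true) (hn : c.nccOK = true) {ℓ : ℕ} (ea : ℚ) (t : ℕ)
    (XA YA : List MI)
    (hXA : ∀ k < c.N, MI.mem c.S (((c.u k : ℚ) : ℝ) ^ ((ea : ℚ) : ℝ)) (miAt XA k))
    (hYA : ∀ k < c.N, MI.mem c.S (((c.v k : ℚ) : ℝ) ^ ((ea : ℚ) : ℝ)) (miAt YA k))
    (nF : ℕ) {J : ℕ} (hJ : ℓ + nF ≤ J)
    (hside : cellSideOK ℓ ea (ea + atomExp c.rho t) nF = true) (hst : c.stepOKC t = true)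
    (parts : List (ℕ × ℕ × ℤ)) (hcov : partsOK nF parts = true)
    (hparts : ∀ p ∈ parts,
      p.2.2 ≤ c.cellLoCP c.nccTab (c.legTabs J) (c.legTabsT J) ℓ ea t XA YA nF p.1 p.2.1) :
    0 ≤ headNumber c.wR c.zR c.zbR ℓ (((2 * ea : ℚ)) : ℝ) (((2 * (ea + atomExp c.rho t) : ℚ)) : ℝ)
      ((c.slo : ℚ) : ℝ) ((c.shi : ℚ) : ℝ) nF true ∧
    ∀ i : Fin c.N, 1 / 2 ≤ (c.zR i * c.zbR i) ^
        (((((2 * (ea + atomExp c.rho t) : ℚ)) : ℝ) - (((2 * ea : ℚ)) : ℝ)) / 2) ∧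
      1 / 2 ≤ ((1 - c.zR i) * (1 - c.zbR i)) ^
        (((((2 * (ea + atomExp c.rho t) : ℚ)) : ℝ) - (((2 * ea : ℚ)) : ℝ)) / 2) := by
  have hS := S_pos hc
  have hSR : (0 : ℝ) < c.S := by exact_mod_cast hS
  simp only [cellSideOK, Bool.and_eq_true, decide_eq_true_eq] at hside
  obtain ⟨hℓ, hall⟩ := hside
  simp only [partsOK, Bool.and_eq_true, decide_eq_true_eq] at hcov
  obtain ⟨hcov, hsum⟩ := hcov
  refine ⟨?_, fun i => ?_⟩
  · have hL := partsSum_le_sum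
      (fun n => qRowC ℓ (c.legTabs J) (c.legTabsT J)
        (c.iuTab (c.duListC false false c.nccTab t XA) ℓ nF) (c.iuTab (c.duListC true false c.nccTab t XA) ℓ nF)
        (c.iuTab (c.duListC false true c.nccTab t XA) ℓ nF) (c.iuTab (c.duListC true true c.nccTab t XA) ℓ nF)
        (c.ivTab (c.dvListC false false c.nccTab t YA) ℓ nF) (c.ivTab (c.dvListC true false c.nccTab t YA) ℓ nF)
        (c.ivTab (c.dvListC false true c.nccTab t YA) ℓ nF) (c.ivTab (c.dvListC true true c.nccTab t YA) ℓ nF)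
        (hrRowList (2 * ea) ℓ nF) (hrRowList (2 * (ea + atomExp c.rho t)) ℓ nF)
        ea (ea + atomExp c.rho t) nF n)
      parts 0 (nF + 1) hcov (fun p hp => by simpa [cellLoCP] using hparts p hp)
    rw [← Finset.range_eq_Ico] at hL
    have hlo := le_trans hsum hL
    have hloR : (0 : ℝ) ≤ ((∑ n ∈ range (nF + 1), qRowC ℓ (c.legTabs J) (c.legTabsT J)
        (c.iuTab (c.duListC false false c.nccTab t XA) ℓ nF) (c.iuTab (c.duListC true false c.nccTab t XA) ℓ nF)
        (c.iuTab (c.duListC false true c.nccTab t XA) ℓ nF) (c.iuTab (c.duListC true true c.nccTab t XA) ℓ nF)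
        (c.ivTab (c.dvListC false false c.nccTab t YA) ℓ nF) (c.ivTab (c.dvListC true false c.nccTab t YA) ℓ nF)
        (c.ivTab (c.dvListC false true c.nccTab t YA) ℓ nF) (c.ivTab (c.dvListC true true c.nccTab t YA) ℓ nF)
        (hrRowList (2 * ea) ℓ nF) (hrRowList (2 * (ea + atomExp c.rho t)) ℓ nF)
        ea (ea + atomExp c.rho t) nF n : ℤ) : ℝ) := by
      exact_mod_cast hlo
    simp only [qRowC, rsum_eq_sum, Int.cast_sum] at hloR
    simp only [headNumber, ↓reduceIte, headChordBound, headCellSum, headSet, Finset.sum_product]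
    have key : ∀ n ∈ range (nF + 1), ∀ j ∈ range (ℓ + nF + 1),
        ((qLoC ℓ (c.legTabs J) (c.legTabsT J)
          (c.iuTab (c.duListC false false c.nccTab t XA) ℓ nF) (c.iuTab (c.duListC true false c.nccTab t XA) ℓ nF)
          (c.iuTab (c.duListC false true c.nccTab t XA) ℓ nF) (c.iuTab (c.duListC true true c.nccTab t XA) ℓ nF)
          (c.ivTab (c.dvListC false false c.nccTab t YA) ℓ nF) (c.ivTab (c.dvListC true false c.nccTab t YA) ℓ nF)
          (c.ivTab (c.dvListC false true c.nccTab t YA) ℓ nF) (c.ivTab (c.dvListC true true c.nccTab t YA) ℓ nF)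
          ((hrRowList (2 * ea) ℓ nF).getD (nF - n) []) ((hrRowList (2 * (ea + atomExp c.rho t)) ℓ nF).getD (nF - n) [])
          (pivotProdQ (2 * ea) ℓ n / pivotProdQ (2 * (ea + atomExp c.rho t)) ℓ n)
          (pivotProdQ (2 * (ea + atomExp c.rho t)) ℓ n / pivotProdQ (2 * ea) ℓ n) n j : ℤ) : ℝ) ≤
        c.S * min
          (hrCoeff (((2 * ea : ℚ)) : ℝ) ℓ n j *
              (pivotProd (((2 * ea : ℚ)) : ℝ) ℓ n / pivotProd (((2 * (ea + atomExp c.rho t) : ℚ)) : ℝ) ℓ n) *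
            termChordMin c.wR c.zR c.zbR j ((c.slo : ℚ) : ℝ) ((c.shi : ℚ) : ℝ)
              ((((2 * ea : ℚ)) : ℝ) + (n : ℕ)) ((((2 * (ea + atomExp c.rho t) : ℚ)) : ℝ) + (n : ℕ)))
          (hrCoeff (((2 * (ea + atomExp c.rho t) : ℚ)) : ℝ) ℓ n j *
              (pivotProd (((2 * (ea + atomExp c.rho t) : ℚ)) : ℝ) ℓ n / pivotProd (((2 * ea : ℚ)) : ℝ) ℓ n) *
            termChordMin c.wR c.zR c.zbR j ((c.slo : ℚ) : ℝ) ((c.shi : ℚ) : ℝ)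
              ((((2 * ea : ℚ)) : ℝ) + (n : ℕ)) ((((2 * (ea + atomExp c.rho t) : ℚ)) : ℝ) + (n : ℕ))) := by
      intro n hn' j hj
      rw [mem_range] at hn' hj
      have hrow := of_rall hall hn'
      simp only [Bool.and_eq_true, decide_eq_true_eq] at hrow
      obtain ⟨⟨hpa, hpb⟩, hAB⟩ := hrow
      have hab := of_rall hAB hj
      simp only [Bool.and_eq_true, decide_eq_true_eq] at hab
      rw [hrRowList_getD _ _ _ _ (by omega), hrRowList_getD _ _ _ _ (by omega)]
      exact qLoC_le hc hn hℓ ea t hst XA YA hXA hYA nF hJ (by omega) (by omega) hpa hpb hab.1 hab.2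
    have := sum_le_sum fun n hn' => sum_le_sum fun j hj => key n hn' j hj
    simp only [← mul_sum] at this
    push_cast at this hloR ⊢
    nlinarith [this, hloR, hSR]
  · have hst' := of_rall hst i.isLt
    simp only [Bool.and_eq_true, decide_eq_true_eq] at hst'
    obtain ⟨⟨_, hU⟩, hV⟩ := hst'
    have e : ((((2 * (ea + atomExp c.rho t) : ℚ)) : ℝ) - (((2 * ea : ℚ)) : ℝ)) / 2 =
        ((atomExp c.rho t : ℚ) : ℝ) := by push_cast; ring
    have hu : c.zR i * c.zbR i = ((c.u i : ℚ) : ℝ) := by simp [zR, zbR, PCert.u]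
    have hv : (1 - c.zR i) * (1 - c.zbR i) = ((c.v i : ℚ) : ℝ) := by simp [zR, zbR, PCert.v]
    rw [e, hu, hv]
    exact ⟨half_le_of_checkHalf hU, half_le_of_checkHalf hV⟩

variable (c)

/-! ### One-cell head segments checked in parts -/

/-- the side checks of a one-cell head segment: atom tables, `nccOK`, the request, the shape
(exactly one cell), the Legendre depth, the cell side conditions and — for a chord cell — the step
checks. [folklore] -/
def hPartSideOK (s : HSeg) (J : ℕ) : Bool :=
  let t := s.steps.headD 0
  let nF := s.nFs.headD 0
  let b := s.bits.headD false
  let e := s.r0.expo c.rho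
  decide (c.atomsU.length = c.N) && decide (c.atomsV.length = c.N) && c.nccOK && s.r0.ok &&
  decide (s.steps.length = 1) && decide (s.nFs.length = 1) && decide (s.bits.length = 1) &&
  decide (s.ell + nF ≤ J) && cellSideOK s.ell e (e + atomExp c.rho t) nF && (!b || c.stepOKC t)

/-- **Part check** of the cell of a one-cell head segment: its end-point enclosures are recomputed
from the request `s.r0`, and the partial lower sum over the levels `[n_lo, n_lo + cnt)` (corner or
chord by the rule bit) is compared with the claim `B`. [folklore] -/
def hPartOK (s : HSeg) (J nlo cnt : ℕ) (B : ℤ) : Bool :=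
  let t := s.steps.headD 0
  let nF := s.nFs.headD 0
  let b := s.bits.headD false
  let e := s.r0.expo c.rho
  let X := c.X0 s.r0
  let Y := c.Y0 s.r0
  bif b then decide (B ≤ c.cellLoCP c.nccTab (c.legTabs J) (c.legTabsT J) s.ell e t X Y nF nlo cnt)
  else decide (B ≤ c.cellLoP c.ncTab (c.legTabs J) (c.legTabsT J) s.ell e (e + atomExp c.rho t) X
    (stepAll c.S c.atomsU t X) Y (stepAll c.S c.atomsV t Y) nF nlo cnt)

variable {c}

/-- **Soundness of a one-cell head segment checked in parts**: it delivers the `CellFact` of its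
cell, exactly as `hBlockOK_sound` does for block-checked segments. [folklore] -/
theorem hParts_sound (hc : c.checkNodes = true) (s : HSeg) (J : ℕ) (parts : List (ℕ × ℕ × ℤ))
    (hside : c.hPartSideOK s J = true) (hcov : partsOK (s.nFs.headD 0) parts = true)
    (hparts : ∀ p ∈ parts, c.hPartOK s J p.1 p.2.1 p.2.2 = true) :
    ∀ x ∈ segCells c.rho s, c.CellFact s.ell x := by
  have hS := S_pos hc
  simp only [hPartSideOK, Bool.and_eq_true, decide_eq_true_eq] at hside
  obtain ⟨⟨⟨⟨⟨⟨⟨⟨⟨hAU, hAV⟩, hn⟩, hok⟩, hl1⟩, hl2⟩, hl3⟩, hJ⟩, hcs⟩, hstb⟩ := hside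
  obtain ⟨t, ht⟩ := List.length_eq_one_iff.1 hl1
  obtain ⟨nF, hnF⟩ := List.length_eq_one_iff.1 hl2
  obtain ⟨b, hb⟩ := List.length_eq_one_iff.1 hl3
  simp only [ht, hnF, hb, List.headD_cons] at hJ hcs hstb hcov
  have hX : ∀ k < c.N, MI.mem c.S (((c.u k : ℚ) : ℝ) ^ ((s.r0.expo c.rho : ℚ) : ℝ))
      (miAt (c.X0 s.r0) k) := fun k hk => by
    simp only [miAt, X0, getD_vtab _ _ _ hk]
    exact mem_powU (checkNode_of_checkNodes hc hk) hS _ hok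
  have hY : ∀ k < c.N, MI.mem c.S (((c.v k : ℚ) : ℝ) ^ ((s.r0.expo c.rho : ℚ) : ℝ))
      (miAt (c.Y0 s.r0) k) := fun k hk => by
    simp only [miAt, Y0, getD_vtab _ _ _ hk]
    exact mem_powV (checkNode_of_checkNodes hc hk) hS _ hok
  intro x hx
  simp only [segCells, ht, hnF, hb, cellsOf, List.mem_cons, List.not_mem_nil, or_false] at hx
  subst hx
  cases b
  · -- corner cell
    have hparts' : ∀ p ∈ parts, p.2.2 ≤ c.cellLoP c.ncTab (c.legTabs J) (c.legTabsT J) s.ell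
        (s.r0.expo c.rho) (s.r0.expo c.rho + atomExp c.rho t) (c.X0 s.r0)
        (stepAll c.S c.atomsU t (c.X0 s.r0)) (c.Y0 s.r0) (stepAll c.S c.atomsV t (c.Y0 s.r0)) nF
        p.1 p.2.1 := fun p hp => by
      have := hparts p hp
      simpa [hPartOK, ht, hnF, hb] using this
    have hX' := mem_stepAll_U hc hAU t (s.r0.expo c.rho) (c.X0 s.r0) (by simp [X0, vtab]) hX
    have hY' := mem_stepAll_V hc hAV t (s.r0.expo c.rho) (c.Y0 s.r0) (by simp [Y0, vtab]) hY
    exact ⟨cellP_sound hc _ _ _ _ _ _ hX hX' hY hY' nF hJ hcs parts hcov hparts', fun h => by simp at h⟩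
  · -- chord cell
    have hst : c.stepOKC t = true := by simpa using hstb
    have hparts' : ∀ p ∈ parts, p.2.2 ≤ c.cellLoCP c.nccTab (c.legTabs J) (c.legTabsT J) s.ell
        (s.r0.expo c.rho) t (c.X0 s.r0) (c.Y0 s.r0) nF p.1 p.2.1 := fun p hp => by
      have := hparts p hp
      simpa [hPartOK, ht, hnF, hb] using this
    have := cellCP_sound hc hn _ t _ _ hX hY nF hJ hcs hst parts hcov hparts'
    exact ⟨this.1, fun _ => this.2⟩

/-- assembling `∀ p ∈ parts` from one fact per part (the parts are `decide`d one by one). [folklore] -/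
theorem forall_mem_cons_of {α : Type*} {P : α → Prop} {a : α} {l : List α} (ha : P a)
    (hl : ∀ x ∈ l, P x) : ∀ x ∈ a :: l, P x := by
  intro x hx
  rw [List.mem_cons] at hx
  rcases hx with rfl | hx
  · exact ha
  · exact hl x hx

/-- the empty case. [folklore] -/
theorem forall_mem_nil' {α : Type*} (P : α → Prop) : ∀ x ∈ ([] : List α), P x := by
  intro x hx; simp at hx

end PCert

end PointKernel

end Literature.MathematicalPhysics.QuantumFieldTheory.ConformalBootstrap3D
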